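import Literature.MathematicalPhysics.QuantumFieldTheory.Balaban1983to89.B8LeafKnitZd3Letters
import Literature.MathematicalPhysics.QuantumFieldTheory.Balaban1983to89.B8SockHFPRD
import Literature.MathematicalPhysics.QuantumFieldTheory.Balaban1983to89.B8SockP5uEAssembly

/-!
# `Balaban1983to89.B8LeafKnitZd3LettersRD` — [Balaban1985RegularSpaces] Lemma 1 – Thm 8: THE N05 KNIT WITH THE PROPOSITION-5 SOCKETS SERVED BY [4]'s LETTERS, INVERSE
# LAWS ON PRINT'S DOMAINS — `B8LeafKnitZd3LettersRange` (p464157) re-run on the letters socket `B8SockLettersRD.SockLettersRD` (no total left-inverse law, right-inverse law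
# of `G′` pointwise on `Ω₀`, `C` in range form; dag-ref-A W8/W8′), with and without Proposition 5's uniqueness socket `SockP5uE` discharged by `pub-ymgap-dag-n04-b`'s
# `exists_threshold_sockP5uE`

statement-level skeleton of published theorems with citation tags; proofs where landed; nothing here is a claim about the
Yang–Mills mass gap

PDF held: `paper:balaban1985-cmp99-regular-spaces-gauge-fixing` (journal page = PDF page + 74); pp. 79–101 (Lemma 1 – Thm 8), p. 88 (Thm 4), p. 89, p. 77, pp. 91–95 (Sect. D,
Prop. 5 (1.106)–(1.109)).  [4] = [Balaban1985BackgroundPropagators] (Thm 3.1 p. 397, (3.25) p. 394, Thms 3.2–3.3 pp. 397–398).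

WHY THIS FILE (cell `pub-ymgap`, R134 acceleration seat `pub-ymgap-dag-n05-d` (g2), strategy s2 = BY-NAME KNIT of DAG node N05 = [B8]; dag-lead REBALANCE №56 (a); count-neutral).
Referee dag-ref-A g12's W8′ (READ-15, kernel-certified): the letters sockets `SockLetters`/`SockLettersR` consumed by the knits `B8LeafKnitZd3Letters`/`B8LeafKnitZd3LettersRange`
state [4]'s inverse laws of `G′` as total identities on all functions `ℤᵈ → 𝔸`, FALSE at every member with finite `Ω₀` — the knits are then vacuous at exactly the members the
cube seats build.  `B8SockHFPRD` serves `SockHFP₀`/`SockHFP` from the socket `SockLettersRD` whose laws live on print's domains ([4] Thm 3.1: `G′` inverts the Dirichlet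
operator on functions on `Ω₀`; (3.25): `C` on the range of `Q′`) with one threshold (`exists_threshold_sockHFP_pairRD`); §1 re-runs the two knit theorems on it, §2 also
discharges the uniqueness binder `SockP5uE` by n04-b's `exists_threshold_sockP5uE` (p461510) from the uniqueness-letters family `SLetU` — signatures = p464157's with
`SockLettersR` ↦ `SockLettersRD`, proofs verbatim.  After §2 the N05 knit over an index map `ι` rests on: [4]'s two letters families at every `ι j` (existence side on
print's domains, uniqueness side `SLetU`), the b9 socket `SB9all` at every `ι j`, the member laws (L1)/(L2), `Ω₀ = ℤᵈ`, the free-constant condition, and the five printed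
members `p5e p5u p6 p7 t8S` — no Proposition-5 socket left.

WHAT THIS FILE PROVES (kernel, 0 sorry, theorems only):
* §1 **`b8LeafRS_zd3_map_lettersRD`**, **`thm2_of135_zd3_map_lettersRD`** — p464157's §1 with `SLet : ∀ j, SockLettersRD …`;
* §2 **`b8LeafRS_zd3_map_lettersRDU`**, **`thm2_of135_zd3_map_lettersRDU`** — p464157's §2 (uniqueness socket discharged by `SLetU`) with `SLet : ∀ j, SockLettersRD …`.

HONEST SCOPE.  Composition by name; [4] Thms 3.1–3.3 (both letters families), [4] Thm 3.3 in Prop. 3's frame (`SB9all`) and the five printed members remain hypotheses;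
at a member whose bond classes `Λb` are empty the b9 socket is unsatisfiable (dag-ref-A J2′) — the theorems are then vacuous AT THAT MEMBER (the laws are displayed per member);
the uniqueness family `SLetU` keeps n04-b's total `g_left` (INBOX W8″: to be audited on that side).  N05 NOT discharged; one finite T⁴ programme at fixed ε; nothing continuum ∕
ℝ⁴ ∕ OS ∕ mass-gap ∕ Clay.  Unit `pub-ymgap-dag-n05-d` (g2), 2026-08-26.
-/


noncomputable section

open NormedSpace

namespace Literature.MathematicalPhysics.QuantumFieldTheory.Balaban1983to89.B8LeafKnitZd3LettersRD

open B7Prop1Explicit B7Prop2Explicit B7Prop1Local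
open B8Ineq132 (InAk BondTouches Under)
open B8Lemma1NonAbelian (mulCfg blockPairNA)
open B8Ineq130 (tlo thi)
open B8LeafKnitRS (B8LeafRS)
open B8LeafModelZd (ZdIdx)
open B8LeafModelZdSockP5uE (SockP5uE)
open B8LeafModelZd3 (zdGF3 SockB9P3)
open B8SockLettersRD (SockLettersRD)
open B8SockHFPRD (exists_threshold_sockHFP_pairRD)
open B8SockP5uEAssembly (exists_threshold_sockP5uE)
open B8Ineq132 (covDerivFwd)
open B7Eq78Linearization (zdBlocking QprimeIter)
open B8Eq119TwistedAxial (bgT)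
open B8Eq140Level (SideTouches)
open B8Eq138LandauZd (covLap QT)
open B8Eq1117Concrete (XSpace)
open B8Prop5ContractionKLevel (Bd2)
open B8LambdaSpaceKLevel (wt)
open B8LeafKnitZd3E (b8LeafRS_zd3_map_b9allE thm2_of135_zd3_map_b9allE)
open QuantumLattice (blockSites)

-- `Site` alone could resolve to the torus sites of `Setup.lean`; re-export the `ℤ^d` sites of `B7Prop1Explicit`.
export B7Prop1Explicit (Site)

variable {d : ℕ}


section KnitRD

variable {𝔸 : Type} [CStarAlgebra 𝔸] [Nontrivial 𝔸]
variable {I₃ I₄ : Type} {lan : I₃ → B8.LandauData} {cub : I₄ → B8.CubeData}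

/-- **THE N05 KNIT OVER AN INDEX MAP `ι`, PROPOSITION-5 FIXED-POINT SOCKETS SERVED BY [4]'s LETTERS WITH THE INVERSE LAWS ON PRINT'S DOMAINS** —
`B8LeafKnitZd3Letters.b8LeafRS_zd3_map_lettersE` VERBATIM with the letters socket `SockLettersRD` (dag-ref-A W8/W8′) and `exists_threshold_sockHFP_pairRD`.  For `d, L ≥ 2`, the leaf's inputs `inp` with `2 ≤ 5dL·inp.B₀`,
`B₀(β₀) > 0`, `C₂ ≥ 2097152(d+1)²`, [4]-letters constants `B₀′_H > 0`, `B₂′, B_G, B_R ≥ 0` with threshold `c_L > 0`, b9 threshold `c_b9 > 0`, Prop. 5's uniqueness radius `cu`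
with threshold `cu′ > 0`, THE FREE-CONSTANT CONDITION `3·(2dL²)·B_G·B_R ≤ inp.B₀′` (p. 93 «with RD*A subtracted»), an index map `ι : J → ZdIdx d L` into `Ω₀ = ℤᵈ` members
(`hΩ`) carrying (L1) towers ⊂ Ω_j AT EVERY TRUNCATION and (L2) INDEX LAW №8 (p. 89), the letters socket `SockLettersRD`, the uniqueness socket `SockP5uE` and the b9
socket `SB9all` at every `ι j`, and the five printed members `p5e p5u p6 p7 t8S` — the surviving leaf over `fun j => zdGF3 𝔸 L β len (ι j)`.  Proof: n05-a g7's
`b8LeafRS_zd3_map_b9allE` with `SockHFP₀`∕`SockHFP` := `exists_threshold_sockHFP_pairRD` (ONE threshold `c_F` for the whole family).  NOT a discharge of N05.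
[cite: Balaban1985RegularSpaces, Lemma 1 p.79, Thm 2 p.83, Prop. 3 p.87, Thm 4 p.88, Prop. 5 (1.106)–(1.109) p.94, (1.102)–(1.103) p.93 (kernel instances + the letters route); Prop. 6 p.99, Prop. 7 p.100, Thm 8 p.101 (named hypotheses); Balaban1985BackgroundPropagators, Thms 3.1–3.3 pp.397–398 (the letters, hypotheses)] -/
theorem b8LeafRS_zd3_map_lettersRD (hd2 : 2 ≤ d) {L : ℕ} (hL : 2 ≤ L) (Lb : ℕ) (β : ℝ) (len : Site d → ℝ) (inp : B8.B9Inputs)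
    {B₀β C₂ cu cu' cB9 B₁ B₂ c₁ B₀'H B₂' BG BR cL : ℝ} (hB : 2 ≤ 5 * (d : ℝ) * L * inp.B₀) (hB₀β : 0 < B₀β)
    (hC₂ : 2097152 * ((d : ℝ) + 1) ^ 2 ≤ C₂) (hcu : 0 < cu) (hcu' : 0 < cu') (hcB9 : 0 < cB9)
    (hB₀'H : 0 < B₀'H) (hB₂' : 0 ≤ B₂') (hBG : 0 ≤ BG) (hBR : 0 ≤ BR) (hcL : 0 < cL)
    (hfree : 3 * (2 * (d : ℝ) * (L : ℝ) ^ 2) * BG * BR ≤ inp.B₀')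
    {J : Type} (ι : J → ZdIdx d L) (hΩ : ∀ j, (ι j).Ω 0 = Set.univ)
    -- the two member laws the letters route reads, at every member of the map
    (hL1 : ∀ j : J, ∀ m, m ≤ (ι j).k → ∀ n, n ≤ m → ∀ y ∈ (ι j).Λs m n, ∀ x, InBox (tlo L y n) (thi L y n) x → x ∈ (ι j).Ω n)
    (hL2lt : ∀ j : J, ∀ m, m < (ι j).k → ∀ n, n < m → (ι j).Λs m n = (ι j).Λs (m + 1) n)
    (hL2top : ∀ j : J, ∀ m, m < (ι j).k → ∀ x, x ∈ (ι j).Λs m m ↔ x ∈ (ι j).Λs (m + 1) m ∨ ∃ y ∈ (ι j).Λs (m + 1) (m + 1), x ∈ blockSites L y)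
    -- the sockets at every member of the map
    (SLet : ∀ j : J, SockLettersRD (𝔸 := 𝔸) L BG BR B₀'H B₂' cL (ι j).η (ι j).k (ι j).Ω (ι j).Λs)
    (SP5u : ∀ j : J, SockP5uE (𝔸 := 𝔸) L inp.B₀ cu' cu (ι j).η (ι j).k (ι j).Ω (ι j).Λs)
    (SB9all : ∀ j : J, ∀ m, m ≤ (ι j).k → SockB9P3 (𝔸 := 𝔸) L inp.B₀ B₀β cB9 β len (ι j).η m (ι j).Ω (ι j).Λs (ι j).Λb)
    {toAxial : ∀ j : J, (zdGF3 𝔸 L β len (ι j)).Cfg → (zdGF3 𝔸 L β len (ι j)).Pert → (zdGF3 𝔸 L β len (ι j)).Pert}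
    (p5e : B8.Prop5Exists inp.B₀' B₁ lan) (p5u : B8.Prop5Unique lan) (p6 : B8.Prop6Printed d (L : ℝ) B₁ c₁ cub)
    (p7 : B8SectGH.Prop7PrintedR (fun j : J => zdGF3 𝔸 L β len (ι j)) toAxial)
    (t8 : B8Thm8Surviving.Thm8SurvivingAt 1 B₁ B₂ (fun j : J => zdGF3 𝔸 L β len (ι j))) :
    B8LeafRS d (L : ℝ) C₂ (5 * (d : ℝ) * L * inp.B₀) inp.B₀' B₁ B₂ c₁ inp B₀β (blockPairNA d Lb 𝔸)
      (fun j : J => zdGF3 𝔸 L β len (ι j)) lan cub toAxial := by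
  obtain ⟨cF, hcF, hpair⟩ := exists_threshold_sockHFP_pairRD (𝔸 := 𝔸) hd2 hL inp.B₀_pos inp.B₀'_pos hB hB₀'H hB₂' hBG hBR hcB9 hcL hfree
  exact b8LeafRS_zd3_map_b9allE hd2 hL Lb β len inp hB hB₀β hC₂ hcu hcF hcF hcu' hcB9 ι hΩ
    (fun j => (hpair (ι j).hη (ι j).hk (ι j).hΩ (ι j).hbox (ι j).hclass (hL1 j) (hL2lt j) (hL2top j) (SLet j) (SB9all j)).1)
    (fun j => (hpair (ι j).hη (ι j).hk (ι j).hΩ (ι j).hbox (ι j).hclass (hL1 j) (hL2lt j) (hL2top j) (SLet j) (SB9all j)).2)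
    SP5u SB9all p5e p5u p6 p7 t8

end KnitRD

section Thm2RD

variable {𝔸 : Type} [CStarAlgebra 𝔸] [Nontrivial 𝔸]

/-- **THEOREM 2 AS PRINTED ((1.35) on Λ_j; chair R453 (C)) OVER AN INDEX MAP `ι`, PROPOSITION-5 FIXED-POINT SOCKETS SERVED BY [4]'s LETTERS, INVERSE LAWS ON PRINT'S
DOMAINS** — n05-a g7's `thm2_of135_zd3_map_b9allE` with `SockHFP₀`∕`SockHFP` := `exists_threshold_sockHFP_pairRD`; hypotheses as in `b8LeafRS_zd3_map_lettersRD` minus the leaf's residual data;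
index law №11 (`cover`) is the displayed first hypothesis of the conclusion, as in n05-a's statement.
[cite: Balaban1985RegularSpaces, Thm 2 p.83, (1.35) p.82, (1.65) p.87, Thm 4 p.88, Prop. 5 (1.106)–(1.109) p.94, (1.59) p.86; Balaban1985BackgroundPropagators, Thms 3.1–3.3 pp.397–398] -/
theorem thm2_of135_zd3_map_lettersRD (hd2 : 2 ≤ d) {L : ℕ} (hL : 2 ≤ L) {β : ℝ} {len : Site d → ℝ}
    {B₀ B₀' B₀β cu cu' cB9 B₀'H B₂' BG BR cL : ℝ} (hB₀ : 0 < B₀) (hB₀' : 0 < B₀') (hB₀β : 0 < B₀β) (hB : 2 ≤ 5 * (d : ℝ) * L * B₀)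
    (hcu : 0 < cu) (hcu' : 0 < cu') (hcB9 : 0 < cB9) (hB₀'H : 0 < B₀'H) (hB₂' : 0 ≤ B₂') (hBG : 0 ≤ BG) (hBR : 0 ≤ BR) (hcL : 0 < cL)
    (hfree : 3 * (2 * (d : ℝ) * (L : ℝ) ^ 2) * BG * BR ≤ B₀')
    {J : Type} (ι : J → ZdIdx d L) (hΩ : ∀ j, (ι j).Ω 0 = Set.univ)
    (hL1 : ∀ j : J, ∀ m, m ≤ (ι j).k → ∀ n, n ≤ m → ∀ y ∈ (ι j).Λs m n, ∀ x, InBox (tlo L y n) (thi L y n) x → x ∈ (ι j).Ω n)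
    (hL2lt : ∀ j : J, ∀ m, m < (ι j).k → ∀ n, n < m → (ι j).Λs m n = (ι j).Λs (m + 1) n)
    (hL2top : ∀ j : J, ∀ m, m < (ι j).k → ∀ x, x ∈ (ι j).Λs m m ↔ x ∈ (ι j).Λs (m + 1) m ∨ ∃ y ∈ (ι j).Λs (m + 1) (m + 1), x ∈ blockSites L y)
    (SLet : ∀ j : J, SockLettersRD (𝔸 := 𝔸) L BG BR B₀'H B₂' cL (ι j).η (ι j).k (ι j).Ω (ι j).Λs)
    (SP5u : ∀ j : J, SockP5uE (𝔸 := 𝔸) L B₀ cu' cu (ι j).η (ι j).k (ι j).Ω (ι j).Λs)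
    (SB9all : ∀ j : J, ∀ m, m ≤ (ι j).k → SockB9P3 (𝔸 := 𝔸) L B₀ B₀β cB9 β len (ι j).η m (ι j).Ω (ι j).Λs (ι j).Λb) :
    ∃ B₁ B₂ c₁ : ℝ, 0 < B₁ ∧ 0 < B₂ ∧ 0 < c₁ ∧
      ∀ i : J,
        (∀ ℓ, ℓ ≤ (ι i).k → ∀ w : Site d, (∀ x, InBox (tlo L w ℓ) (thi L w ℓ) x → x ∈ (ι i).Ω ℓ) →
          ∃ j, ℓ ≤ j ∧ j ≤ (ι i).k ∧ ∃ y ∈ (ι i).Λs (ι i).k j, Under L (j - ℓ) y w) →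
        ∀ α₀ α₁ : ℝ, 0 < α₀ → 0 < α₁ → α₀ + α₁ ≤ c₁ →
          ∀ (U₀ : (zdGF3 𝔸 L β len (ι i)).Cfg) (P : (zdGF3 𝔸 L β len (ι i)).Pert),
            (zdGF3 𝔸 L β len (ι i)).InA α₀ U₀ → (zdGF3 𝔸 L β len (ι i)).Reg335 α₀ U₀ → (zdGF3 𝔸 L β len (ι i)).InAAx α₀ U₀ P →
            (∀ j, j ≤ (ι i).k → ∀ (z : Site d) (μ : Fin d), BondTouches ((ι i).Λs (ι i).k j) z μ →
              (∀ x, InBox (loK L j z) (bondHiK L j z μ) x → x ∈ (ι i).Ω j) →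
              ‖(avgIter L (mulCfg P.2.1 U₀.1) j z μ : 𝔸) - (avgIter L U₀.1 j z μ : 𝔸)‖ ≤ α₁) →
            ∃ u : (zdGF3 𝔸 L β len (ι i)).GT, (zdGF3 𝔸 L β len (ι i)).Restricted U₀ u ∧
              ((zdGF3 𝔸 L β len (ι i)).C136 B₁ B₂ (α₀ + (11 * (d : ℝ) ^ 2 * α₀ + α₁)) U₀ ((zdGF3 𝔸 L β len (ι i)).act P u) ∧
                (zdGF3 𝔸 L β len (ι i)).C137 α₁ U₀ ((zdGF3 𝔸 L β len (ι i)).act P u) ∧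
                (zdGF3 𝔸 L β len (ι i)).Landau U₀ ((zdGF3 𝔸 L β len (ι i)).act P u) ∧
                (zdGF3 𝔸 L β len (ι i)).C139 B₁ (α₀ + (11 * (d : ℝ) ^ 2 * α₀ + α₁)) U₀ ((zdGF3 𝔸 L β len (ι i)).act P u)) ∧
              ∀ u' : (zdGF3 𝔸 L β len (ι i)).GT, (zdGF3 𝔸 L β len (ι i)).Restricted U₀ u' →
                (zdGF3 𝔸 L β len (ι i)).C136 B₁ B₂ (α₀ + (11 * (d : ℝ) ^ 2 * α₀ + α₁)) U₀ ((zdGF3 𝔸 L β len (ι i)).act P u') →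
                (zdGF3 𝔸 L β len (ι i)).C137 α₁ U₀ ((zdGF3 𝔸 L β len (ι i)).act P u') →
                (zdGF3 𝔸 L β len (ι i)).Landau U₀ ((zdGF3 𝔸 L β len (ι i)).act P u') →
                (zdGF3 𝔸 L β len (ι i)).C139 B₁ (α₀ + (11 * (d : ℝ) ^ 2 * α₀ + α₁)) U₀ ((zdGF3 𝔸 L β len (ι i)).act P u') →
                  u' = u := by
  obtain ⟨cF, hcF, hpair⟩ := exists_threshold_sockHFP_pairRD (𝔸 := 𝔸) (B₀ := B₀) (B₀' := B₀') hd2 hL hB₀ hB₀' hB hB₀'H hB₂' hBG hBR hcB9 hcL hfree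
  exact thm2_of135_zd3_map_b9allE hd2 hL hB₀ hB₀' hB₀β hB hcu hcF hcF hcu' hcB9 ι hΩ
    (fun j => (hpair (ι j).hη (ι j).hk (ι j).hΩ (ι j).hbox (ι j).hclass (hL1 j) (hL2lt j) (hL2top j) (SLet j) (SB9all j)).1)
    (fun j => (hpair (ι j).hη (ι j).hk (ι j).hΩ (ι j).hbox (ι j).hclass (hL1 j) (hL2lt j) (hL2top j) (SLet j) (SB9all j)).2)
    SP5u SB9all

end Thm2RD

/-! ## §2 The same with Proposition 5's UNIQUENESS socket `SockP5uE` discharged by `pub-ymgap-dag-n04-b`'s `exists_threshold_sockP5uE` -/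

section KnitRDU

variable {𝔸 : Type} [CStarAlgebra 𝔸] [Nontrivial 𝔸]
variable {I₃ I₄ : Type} {lan : I₃ → B8.LandauData} {cub : I₄ → B8.CubeData}

/-- **THE N05 KNIT OVER AN INDEX MAP `ι` WITH NO PROPOSITION-5 SOCKET LEFT, LETTERS ON PRINT'S DOMAINS** — `b8LeafRS_zd3_map_lettersRD` with its uniqueness binder `SP5u : ∀ j, SockP5uE L inp.B₀ cu′ cu …`
DISCHARGED by `B8SockP5uEAssembly.exists_threshold_sockP5uE` (n04-b g5: Prop. 5's uniqueness clause (1.109) at ONE radius `c_u` and ONE threshold for the whole `Ω 0 = univ`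
sub-family) from the UNIQUENESS-LETTERS FAMILY `SLetU` at every `ι j` — [4]'s letters `G′, Δ, Q′, Q′ᵀ, 𝔄, C, H′` at the top structure `(k, Λs k)` with the twelve laws n04-b
displays verbatim (`g_left`, the left inverse of `C` in range form `c_left′`, the readings `hΔ hqs hq`, `Q′` ZERO off `𝔅_k`, (1.92) `hH0 hH1 hH2`, (1.91) `hQH`, (1.101) `hG`,
(1.98) `hRbd`) — and the b9 socket `SB9all` the knit already carries.  Remaining hypotheses: `SockLettersRD` (existence side, laws on print's domains) and `SLetU` (uniqueness side)
at every `ι j` — both [4] Thms 3.1–3.3 for Bałaban's operators — `SB9all` at every `ι j`, the member laws (L1)/(L2), `Ω₀ = ℤᵈ`, `3·(2dL²)·B_G·B_R ≤ inp.B₀′`, and `p5e p5u p6 p7 t8S`.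
NOT a discharge of N05. [cite: Balaban1985RegularSpaces, Lemma 1 p.79, Thm 2 p.83, Prop. 3 p.87, Thm 4 p.88, Prop. 5 (1.106)–(1.109) p.94 («c₂, c₃»), (1.102)–(1.103) p.93; Prop. 6 p.99, Prop. 7 p.100, Thm 8 p.101 (named hypotheses); Balaban1985BackgroundPropagators, Thms 3.1–3.3 pp.397–398, (3.25) p.394] -/
theorem b8LeafRS_zd3_map_lettersRDU (hd2 : 2 ≤ d) {L : ℕ} (hL : 2 ≤ L) (Lb : ℕ) (β : ℝ) (len : Site d → ℝ) (inp : B8.B9Inputs)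
    {B₀β C₂ cB9 B₁ B₂ c₁ B₀'H B₂' BG BR cL : ℝ} (hB : 2 ≤ 5 * (d : ℝ) * L * inp.B₀) (hB₀β : 0 < B₀β)
    (hC₂ : 2097152 * ((d : ℝ) + 1) ^ 2 ≤ C₂) (hcB9 : 0 < cB9)
    (hB₀'H : 0 < B₀'H) (hB₂' : 0 ≤ B₂') (hBG : 0 ≤ BG) (hBR : 0 ≤ BR) (hcL : 0 < cL)
    (hfree : 3 * (2 * (d : ℝ) * (L : ℝ) ^ 2) * BG * BR ≤ inp.B₀')
    {J : Type} (ι : J → ZdIdx d L) (hΩ : ∀ j, (ι j).Ω 0 = Set.univ)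
    -- the two member laws the letters route reads, at every member of the map
    (hL1 : ∀ j : J, ∀ m, m ≤ (ι j).k → ∀ n, n ≤ m → ∀ y ∈ (ι j).Λs m n, ∀ x, InBox (tlo L y n) (thi L y n) x → x ∈ (ι j).Ω n)
    (hL2lt : ∀ j : J, ∀ m, m < (ι j).k → ∀ n, n < m → (ι j).Λs m n = (ι j).Λs (m + 1) n)
    (hL2top : ∀ j : J, ∀ m, m < (ι j).k → ∀ x, x ∈ (ι j).Λs m m ↔ x ∈ (ι j).Λs (m + 1) m ∨ ∃ y ∈ (ι j).Λs (m + 1) (m + 1), x ∈ blockSites L y)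
    -- [4]'s letters at every member of the map: existence side (laws on print's domains) and uniqueness side (n04-b's twelve laws at the top structure)
    (SLet : ∀ j : J, SockLettersRD (𝔸 := 𝔸) L BG BR B₀'H B₂' cL (ι j).η (ι j).k (ι j).Ω (ι j).Λs)
    (SLetU : ∀ j : J, ∀ α₀ : ℝ, 0 < α₀ → α₀ ≤ cL → ∀ U₀ : Site d → Fin d → 𝔸ˣ, (∀ x κ, U₀ x κ ∈ unitaryUnits 𝔸) →
      InAk L (ι j).k (ι j).η α₀ (ι j).Ω U₀ →
      ∃ (g Δ : (Site d → 𝔸) →ₗ[ℂ] (Site d → 𝔸)) (q : (Site d → 𝔸) →ₗ[ℂ] (ℕ → Site d → 𝔸)) (qs : (ℕ → Site d → 𝔸) →ₗ[ℂ] (Site d → 𝔸))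
        (Aw c : (ℕ → Site d → 𝔸) →ₗ[ℂ] (ℕ → Site d → 𝔸)) (H' : XSpace d (ι j).k 𝔸 →ₗ[ℂ] (Site d → 𝔸)),
        (∀ x, g (Δ x + qs (Aw (q x))) = x) ∧ (∀ φ, qs (c (q (g (g (qs φ))))) = qs φ) ∧
        (∀ (f : Site d → 𝔸), ∀ x ∈ (ι j).Ω 0, Δ f x = covLap (ι j).η U₀ (((ι j).Ω 0).indicator f) x) ∧
        (∀ (μ : ℕ → Site d → 𝔸), ∀ x ∈ (ι j).Ω 0, qs μ x = QT L (ι j).k ((ι j).Λs (ι j).k) U₀ μ x) ∧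
        (∀ (f : Site d → 𝔸) (n : ℕ), n ≤ (ι j).k → ∀ y ∈ (ι j).Λs (ι j).k n, q f n y = QprimeIter (zdBlocking d L) (bgT L U₀) n f y) ∧
        (∀ (f : Site d → 𝔸) (n : ℕ) (y : Site d), ¬ (n ≤ (ι j).k ∧ y ∈ (ι j).Λs (ι j).k n) → q f n y = 0) ∧
        (∀ (X : XSpace d (ι j).k 𝔸) (x : Site d), ‖H' X x‖ ≤ B₀'H * ‖X‖) ∧
        (∀ n, n ≤ (ι j).k → ∀ (X : XSpace d (ι j).k 𝔸), ∀ p ∈ {b : Site d × Fin d | SideTouches ((ι j).Ω n) b.1 b.2},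
          wt L (ι j).η n * ‖covDerivFwd (ι j).η U₀ p.2 (H' X) p.1‖ ≤ B₀'H * ‖X‖) ∧
        (∀ X : XSpace d (ι j).k 𝔸, Bd2 L (ι j).η (ι j).k (ι j).Ω (covLap (ι j).η U₀ (H' X)) (B₂' * ‖X‖)) ∧
        (∀ (Y : XSpace d (ι j).k 𝔸) (n : ℕ) (hn : n ≤ (ι j).k) (y : Site d), y ∈ (ι j).Λs (ι j).k n →
          QprimeIter (zdBlocking d L) (bgT L U₀) n (H' Y) y = Y (⟨n, Nat.lt_succ_of_le hn⟩, y)) ∧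
        (∀ (f : Site d → 𝔸) (r : ℝ), 0 ≤ r → Bd2 L (ι j).η (ι j).k (ι j).Ω f r →
          (∀ x, ‖g f x‖ ≤ BG * r) ∧ ∀ n, n ≤ (ι j).k → ∀ p ∈ {b : Site d × Fin d | SideTouches ((ι j).Ω n) b.1 b.2},
            wt L (ι j).η n * ‖covDerivFwd (ι j).η U₀ p.2 (g f) p.1‖ ≤ BG * r) ∧
        (∀ (f : Site d → 𝔸) (r : ℝ), 0 ≤ r → Bd2 L (ι j).η (ι j).k (ι j).Ω f r → Bd2 L (ι j).η (ι j).k (ι j).Ω (f - g (qs (c (q (g f))))) (BR * r)))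
    (SB9all : ∀ j : J, ∀ m, m ≤ (ι j).k → SockB9P3 (𝔸 := 𝔸) L inp.B₀ B₀β cB9 β len (ι j).η m (ι j).Ω (ι j).Λs (ι j).Λb)
    {toAxial : ∀ j : J, (zdGF3 𝔸 L β len (ι j)).Cfg → (zdGF3 𝔸 L β len (ι j)).Pert → (zdGF3 𝔸 L β len (ι j)).Pert}
    (p5e : B8.Prop5Exists inp.B₀' B₁ lan) (p5u : B8.Prop5Unique lan) (p6 : B8.Prop6Printed d (L : ℝ) B₁ c₁ cub)
    (p7 : B8SectGH.Prop7PrintedR (fun j : J => zdGF3 𝔸 L β len (ι j)) toAxial)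
    (t8 : B8Thm8Surviving.Thm8SurvivingAt 1 B₁ B₂ (fun j : J => zdGF3 𝔸 L β len (ι j))) :
    B8LeafRS d (L : ℝ) C₂ (5 * (d : ℝ) * L * inp.B₀) inp.B₀' B₁ B₂ c₁ inp B₀β (blockPairNA d Lb 𝔸)
      (fun j : J => zdGF3 𝔸 L β len (ι j)) lan cub toAxial := by
  obtain ⟨cF, hcF, hpair⟩ := exists_threshold_sockHFP_pairRD (𝔸 := 𝔸) hd2 hL inp.B₀_pos inp.B₀'_pos hB hB₀'H hB₂' hBG hBR hcB9 hcL hfree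
  obtain ⟨cu, cFu, hcu, hcFu, huniq⟩ := exists_threshold_sockP5uE (𝔸 := 𝔸) hd2 hL inp.B₀_pos hB hB₀'H hB₂' hBG hBR hcB9 hcL
  exact b8LeafRS_zd3_map_b9allE hd2 hL Lb β len inp hB hB₀β hC₂ hcu hcF hcF hcFu hcB9 ι hΩ
    (fun j => (hpair (ι j).hη (ι j).hk (ι j).hΩ (ι j).hbox (ι j).hclass (hL1 j) (hL2lt j) (hL2top j) (SLet j) (SB9all j)).1)
    (fun j => (hpair (ι j).hη (ι j).hk (ι j).hΩ (ι j).hbox (ι j).hclass (hL1 j) (hL2lt j) (hL2top j) (SLet j) (SB9all j)).2)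
    (fun j => huniq (ι j).hη (ι j).hk (ι j).hΩ (hΩ j) (ι j).hbox (ι j).hclass ((hL1 j) (ι j).k le_rfl) (SLetU j) (SB9all j))
    SB9all p5e p5u p6 p7 t8

end KnitRDU

section Thm2RDU

variable {𝔸 : Type} [CStarAlgebra 𝔸] [Nontrivial 𝔸]

/-- **THEOREM 2 AS PRINTED ((1.35) on Λ_j; chair R453 (C)) OVER AN INDEX MAP `ι` WITH NO PROPOSITION-5 SOCKET LEFT, LETTERS ON PRINT'S DOMAINS** — `thm2_of135_zd3_map_lettersRD`
with the uniqueness binder `SP5u` DISCHARGED by n04-b's `exists_threshold_sockP5uE` from the uniqueness-letters family `SLetU` at every `ι j`; hypotheses as in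
`b8LeafRS_zd3_map_lettersRDU` minus the leaf's
residual data. [cite: Balaban1985RegularSpaces, Thm 2 p.83, (1.35) p.82, (1.65) p.87, Thm 4 p.88, Prop. 5 (1.106)–(1.109) p.94, (1.59) p.86; Balaban1985BackgroundPropagators, Thms 3.1–3.3 pp.397–398] -/
theorem thm2_of135_zd3_map_lettersRDU (hd2 : 2 ≤ d) {L : ℕ} (hL : 2 ≤ L) {β : ℝ} {len : Site d → ℝ}
    {B₀ B₀' B₀β cB9 B₀'H B₂' BG BR cL : ℝ} (hB₀ : 0 < B₀) (hB₀' : 0 < B₀') (hB₀β : 0 < B₀β) (hB : 2 ≤ 5 * (d : ℝ) * L * B₀)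
    (hcB9 : 0 < cB9) (hB₀'H : 0 < B₀'H) (hB₂' : 0 ≤ B₂') (hBG : 0 ≤ BG) (hBR : 0 ≤ BR) (hcL : 0 < cL)
    (hfree : 3 * (2 * (d : ℝ) * (L : ℝ) ^ 2) * BG * BR ≤ B₀')
    {J : Type} (ι : J → ZdIdx d L) (hΩ : ∀ j, (ι j).Ω 0 = Set.univ)
    (hL1 : ∀ j : J, ∀ m, m ≤ (ι j).k → ∀ n, n ≤ m → ∀ y ∈ (ι j).Λs m n, ∀ x, InBox (tlo L y n) (thi L y n) x → x ∈ (ι j).Ω n)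
    (hL2lt : ∀ j : J, ∀ m, m < (ι j).k → ∀ n, n < m → (ι j).Λs m n = (ι j).Λs (m + 1) n)
    (hL2top : ∀ j : J, ∀ m, m < (ι j).k → ∀ x, x ∈ (ι j).Λs m m ↔ x ∈ (ι j).Λs (m + 1) m ∨ ∃ y ∈ (ι j).Λs (m + 1) (m + 1), x ∈ blockSites L y)
    (SLet : ∀ j : J, SockLettersRD (𝔸 := 𝔸) L BG BR B₀'H B₂' cL (ι j).η (ι j).k (ι j).Ω (ι j).Λs)
    (SLetU : ∀ j : J, ∀ α₀ : ℝ, 0 < α₀ → α₀ ≤ cL → ∀ U₀ : Site d → Fin d → 𝔸ˣ, (∀ x κ, U₀ x κ ∈ unitaryUnits 𝔸) →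
      InAk L (ι j).k (ι j).η α₀ (ι j).Ω U₀ →
      ∃ (g Δ : (Site d → 𝔸) →ₗ[ℂ] (Site d → 𝔸)) (q : (Site d → 𝔸) →ₗ[ℂ] (ℕ → Site d → 𝔸)) (qs : (ℕ → Site d → 𝔸) →ₗ[ℂ] (Site d → 𝔸))
        (Aw c : (ℕ → Site d → 𝔸) →ₗ[ℂ] (ℕ → Site d → 𝔸)) (H' : XSpace d (ι j).k 𝔸 →ₗ[ℂ] (Site d → 𝔸)),
        (∀ x, g (Δ x + qs (Aw (q x))) = x) ∧ (∀ φ, qs (c (q (g (g (qs φ))))) = qs φ) ∧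
        (∀ (f : Site d → 𝔸), ∀ x ∈ (ι j).Ω 0, Δ f x = covLap (ι j).η U₀ (((ι j).Ω 0).indicator f) x) ∧
        (∀ (μ : ℕ → Site d → 𝔸), ∀ x ∈ (ι j).Ω 0, qs μ x = QT L (ι j).k ((ι j).Λs (ι j).k) U₀ μ x) ∧
        (∀ (f : Site d → 𝔸) (n : ℕ), n ≤ (ι j).k → ∀ y ∈ (ι j).Λs (ι j).k n, q f n y = QprimeIter (zdBlocking d L) (bgT L U₀) n f y) ∧
        (∀ (f : Site d → 𝔸) (n : ℕ) (y : Site d), ¬ (n ≤ (ι j).k ∧ y ∈ (ι j).Λs (ι j).k n) → q f n y = 0) ∧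
        (∀ (X : XSpace d (ι j).k 𝔸) (x : Site d), ‖H' X x‖ ≤ B₀'H * ‖X‖) ∧
        (∀ n, n ≤ (ι j).k → ∀ (X : XSpace d (ι j).k 𝔸), ∀ p ∈ {b : Site d × Fin d | SideTouches ((ι j).Ω n) b.1 b.2},
          wt L (ι j).η n * ‖covDerivFwd (ι j).η U₀ p.2 (H' X) p.1‖ ≤ B₀'H * ‖X‖) ∧
        (∀ X : XSpace d (ι j).k 𝔸, Bd2 L (ι j).η (ι j).k (ι j).Ω (covLap (ι j).η U₀ (H' X)) (B₂' * ‖X‖)) ∧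
        (∀ (Y : XSpace d (ι j).k 𝔸) (n : ℕ) (hn : n ≤ (ι j).k) (y : Site d), y ∈ (ι j).Λs (ι j).k n →
          QprimeIter (zdBlocking d L) (bgT L U₀) n (H' Y) y = Y (⟨n, Nat.lt_succ_of_le hn⟩, y)) ∧
        (∀ (f : Site d → 𝔸) (r : ℝ), 0 ≤ r → Bd2 L (ι j).η (ι j).k (ι j).Ω f r →
          (∀ x, ‖g f x‖ ≤ BG * r) ∧ ∀ n, n ≤ (ι j).k → ∀ p ∈ {b : Site d × Fin d | SideTouches ((ι j).Ω n) b.1 b.2},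
            wt L (ι j).η n * ‖covDerivFwd (ι j).η U₀ p.2 (g f) p.1‖ ≤ BG * r) ∧
        (∀ (f : Site d → 𝔸) (r : ℝ), 0 ≤ r → Bd2 L (ι j).η (ι j).k (ι j).Ω f r → Bd2 L (ι j).η (ι j).k (ι j).Ω (f - g (qs (c (q (g f))))) (BR * r)))
    (SB9all : ∀ j : J, ∀ m, m ≤ (ι j).k → SockB9P3 (𝔸 := 𝔸) L B₀ B₀β cB9 β len (ι j).η m (ι j).Ω (ι j).Λs (ι j).Λb) :
    ∃ B₁ B₂ c₁ : ℝ, 0 < B₁ ∧ 0 < B₂ ∧ 0 < c₁ ∧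
      ∀ i : J,
        (∀ ℓ, ℓ ≤ (ι i).k → ∀ w : Site d, (∀ x, InBox (tlo L w ℓ) (thi L w ℓ) x → x ∈ (ι i).Ω ℓ) →
          ∃ j, ℓ ≤ j ∧ j ≤ (ι i).k ∧ ∃ y ∈ (ι i).Λs (ι i).k j, Under L (j - ℓ) y w) →
        ∀ α₀ α₁ : ℝ, 0 < α₀ → 0 < α₁ → α₀ + α₁ ≤ c₁ →
          ∀ (U₀ : (zdGF3 𝔸 L β len (ι i)).Cfg) (P : (zdGF3 𝔸 L β len (ι i)).Pert),
            (zdGF3 𝔸 L β len (ι i)).InA α₀ U₀ → (zdGF3 𝔸 L β len (ι i)).Reg335 α₀ U₀ → (zdGF3 𝔸 L β len (ι i)).InAAx α₀ U₀ P →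
            (∀ j, j ≤ (ι i).k → ∀ (z : Site d) (μ : Fin d), BondTouches ((ι i).Λs (ι i).k j) z μ →
              (∀ x, InBox (loK L j z) (bondHiK L j z μ) x → x ∈ (ι i).Ω j) →
              ‖(avgIter L (mulCfg P.2.1 U₀.1) j z μ : 𝔸) - (avgIter L U₀.1 j z μ : 𝔸)‖ ≤ α₁) →
            ∃ u : (zdGF3 𝔸 L β len (ι i)).GT, (zdGF3 𝔸 L β len (ι i)).Restricted U₀ u ∧
              ((zdGF3 𝔸 L β len (ι i)).C136 B₁ B₂ (α₀ + (11 * (d : ℝ) ^ 2 * α₀ + α₁)) U₀ ((zdGF3 𝔸 L β len (ι i)).act P u) ∧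
                (zdGF3 𝔸 L β len (ι i)).C137 α₁ U₀ ((zdGF3 𝔸 L β len (ι i)).act P u) ∧
                (zdGF3 𝔸 L β len (ι i)).Landau U₀ ((zdGF3 𝔸 L β len (ι i)).act P u) ∧
                (zdGF3 𝔸 L β len (ι i)).C139 B₁ (α₀ + (11 * (d : ℝ) ^ 2 * α₀ + α₁)) U₀ ((zdGF3 𝔸 L β len (ι i)).act P u)) ∧
              ∀ u' : (zdGF3 𝔸 L β len (ι i)).GT, (zdGF3 𝔸 L β len (ι i)).Restricted U₀ u' →
                (zdGF3 𝔸 L β len (ι i)).C136 B₁ B₂ (α₀ + (11 * (d : ℝ) ^ 2 * α₀ + α₁)) U₀ ((zdGF3 𝔸 L β len (ι i)).act P u') →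
                (zdGF3 𝔸 L β len (ι i)).C137 α₁ U₀ ((zdGF3 𝔸 L β len (ι i)).act P u') →
                (zdGF3 𝔸 L β len (ι i)).Landau U₀ ((zdGF3 𝔸 L β len (ι i)).act P u') →
                (zdGF3 𝔸 L β len (ι i)).C139 B₁ (α₀ + (11 * (d : ℝ) ^ 2 * α₀ + α₁)) U₀ ((zdGF3 𝔸 L β len (ι i)).act P u') →
                  u' = u := by
  obtain ⟨cF, hcF, hpair⟩ := exists_threshold_sockHFP_pairRD (𝔸 := 𝔸) (B₀ := B₀) (B₀' := B₀') hd2 hL hB₀ hB₀' hB hB₀'H hB₂' hBG hBR hcB9 hcL hfree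
  obtain ⟨cu, cFu, hcu, hcFu, huniq⟩ := exists_threshold_sockP5uE (𝔸 := 𝔸) hd2 hL hB₀ hB hB₀'H hB₂' hBG hBR hcB9 hcL
  exact thm2_of135_zd3_map_b9allE hd2 hL hB₀ hB₀' hB₀β hB hcu hcF hcF hcFu hcB9 ι hΩ
    (fun j => (hpair (ι j).hη (ι j).hk (ι j).hΩ (ι j).hbox (ι j).hclass (hL1 j) (hL2lt j) (hL2top j) (SLet j) (SB9all j)).1)
    (fun j => (hpair (ι j).hη (ι j).hk (ι j).hΩ (ι j).hbox (ι j).hclass (hL1 j) (hL2lt j) (hL2top j) (SLet j) (SB9all j)).2)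
    (fun j => huniq (ι j).hη (ι j).hk (ι j).hΩ (hΩ j) (ι j).hbox (ι j).hclass ((hL1 j) (ι j).k le_rfl) (SLetU j) (SB9all j))
    SB9all

end Thm2RDU

#print axioms b8LeafRS_zd3_map_lettersRDU
#print axioms thm2_of135_zd3_map_lettersRDU

end Literature.MathematicalPhysics.QuantumFieldTheory.Balaban1983to89.B8LeafKnitZd3LettersRD

end
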